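import Literature.NumberTheory.EllipticCurves.PeriodLatticeODETransportProofs
import Literature.NumberTheory.EllipticCurves.EichlerIntegralWeierstrassProofs
import Literature.NumberTheory.EllipticCurves.LatticeInclusionRigidityProofs
import HarnessLib

/-!
# The period lattice of a rational weight-`2` cusp form has rational invariants: analytic lemmas

Topic `NumberTheory/EllipticCurves`; a proofs-only file (theorems only, no definitions, no named
facts). Setting: `f ∈ S₂(Γ₀(N))`, `u = 2πi∫_{i∞} f` its Eichler integral, `Λ` a lattice (period
pair `L`) containing the period lattice `Λ_f`, and a presentation `℘_Λ(u(τ))·G(τ) = F(τ)` of the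
`Γ₀(N)`-invariant function `x = ℘_Λ(u)` as a quotient of cusp forms `F, G` on `Γ₁(N)`
(`EichlerIntegralWeierstrassProofs.lean` for `x`). This file supplies the analytic lemmas of the
descent argument for `Λ_f` (see `LatticeInclusionRigidityProofs.lean` for the lattice side and
`PeriodLatticeODETransportProofs.lean` for the transport of the differential equation):

* `odeFun_eq_zero_of_presentation` — the presentation forces the function identity
  `(G·F′ − F·G′)² = (2πi)² f²G(4F³ − g₂FG² − g₃G³)` on `ℍ` (the differential equation
  `x′² = u′²(4x³ − g₂x − g₃)`, `u′ = 2πi f`, of `deriv_weierstrassP_eichlerIntegral_sq`, cleared of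
  denominators, spread over the poles by the identity theorem);
* `deriv_div_sq_of_odeFun_eq_zero` — conversely the identity gives, off the zeros of `G₁`, the
  differential equation `h′² = u′²(4h³ − Ah − B)` for `h = F₁/G₁`;
* `not_const_weierstrassP_eichlerIntegral` — `℘_Λ ∘ u` is not constant on any nonempty open
  subset of the half-plane (a non-constant holomorphic `u` cannot map an open set into the
  countable fibre of `℘_Λ` over a point); with the countability lemmas
  `countable_fiber_eichlerIntegral`, `countable_zeros_cuspForm`, `countable_setOf_smul_mem`
  (generic base points for the descent argument of `PeriodLatticeRationalityProofs.lean`).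

## References

* G. Shimura, *Introduction to the arithmetic theory of automorphic functions*, 1971: §7
  (curves attached to cusp forms; descent of the field of definition). [ShimuraIATAF1971]
* J. E. Cremona, *Algorithms for modular elliptic curves*, 2nd ed., 1997: §2.10. [CremonaAlgorithms1997]
-/

noncomputable section

open Complex Filter Topology Set Function
open UpperHalfPlane hiding I
open scoped Real Topology Manifold MatrixGroups PeriodPair

open Literature.NumberTheory.EllipticCurves

namespace Literature.NumberTheory.EllipticCurves.ModularForms

open CongruenceSubgroup

variable {N : ℕ} [NeZero N] {k : ℤ}

/-! ### Uncountability of open subsets of the half-plane -/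

/-- A nonempty open subset of `ℂ` is not countable (the complement of a countable set is
dense). [folklore] -/
theorem not_countable_of_isOpen {W : Set ℂ} (hW : IsOpen W) (hne : W.Nonempty) : ¬ W.Countable := by
  intro hc
  obtain ⟨z, hz⟩ := (hc.dense_compl ℂ).inter_open_nonempty W hW hne
  exact hz.2 hz.1

/-- A subset of the upper half-plane with countable complement (in the half-plane) is nonempty
and indeed not countable. [folklore] -/
theorem nonempty_diff_of_countable {T : Set ℂ} (hT : T.Countable) :
    ({z : ℂ | 0 < z.im} \ T).Nonempty := by
  by_contra hne
  rw [not_nonempty_iff_eq_empty, sdiff_eq_empty] at hne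
  exact not_countable_of_isOpen isOpen_upperHalfPlaneSet ⟨Complex.I, by simp⟩ (hT.mono hne)

/-! ### From the presentation to the differential identity -/

/-- **The presentation `℘_Λ(u)·G = F` forces the differential identity on `ℍ`.** If
`℘_Λ(u(τ))G(τ) = F(τ)` whenever `u(τ) ∉ Λ`, then
`(G·F′ − F·G′)² − (2πi)²·f²G(4F³ − g₂FG² − g₃G³) = 0` identically on `ℍ` (`′ = d/dz`,
`(g₂, g₃) = (g₂, g₃)(Λ)`): off the (countable, closed) pole set, `F = xG` with `x = ℘_Λ ∘ u`,
so `G·F′ − F·G′ = G² x′` and `x′² = (2πi f)²(4x³ − g₂x − g₃)`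
(`deriv_weierstrassP_eichlerIntegral_sq`); the identity theorem spreads the resulting identity
of holomorphic functions over the whole half-plane. [cite: CremonaAlgorithms1997, §2.10] -/
theorem odeFun_eq_zero_of_presentation (f : CuspForm (Gamma0 N) 2) (hf : f ≠ 0) (L : PeriodPair)
    (F G : CuspForm (Gamma1 N) k)
    (hFG : ∀ τ : ℍ, eichlerIntegral f τ ∉ L.lattice → ℘[L] (eichlerIntegral f τ) * G τ = F τ) :
    (⇑G * (fun τ : ℍ ↦ deriv (⇑F ∘ ofComplex) τ) - ⇑F * (fun τ : ℍ ↦ deriv (⇑G ∘ ofComplex) τ)) *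
        (⇑G * (fun τ : ℍ ↦ deriv (⇑F ∘ ofComplex) τ) - ⇑F * (fun τ : ℍ ↦ deriv (⇑G ∘ ofComplex) τ)) -
      ((2 * π * I) ^ 2 : ℂ) • (⇑f * ⇑f * ⇑G *
        ((4 : ℂ) • (⇑F * ⇑F * ⇑F) - L.g₂ • (⇑F * ⇑G * ⇑G) - L.g₃ • (⇑G * ⇑G * ⇑G))) = 0 := by
  -- notation
  obtain ⟨hΦ, -⟩ := isCuspFunction_and_qExpansion_odeFun f F G L.g₂ L.g₃
  set Φ : ℍ → ℂ := (⇑G * (fun τ : ℍ ↦ deriv (⇑F ∘ ofComplex) τ) -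
      ⇑F * (fun τ : ℍ ↦ deriv (⇑G ∘ ofComplex) τ)) *
        (⇑G * (fun τ : ℍ ↦ deriv (⇑F ∘ ofComplex) τ) - ⇑F * (fun τ : ℍ ↦ deriv (⇑G ∘ ofComplex) τ)) -
      ((2 * π * I) ^ 2 : ℂ) • (⇑f * ⇑f * ⇑G *
        ((4 : ℂ) • (⇑F * ⇑F * ⇑F) - L.g₂ • (⇑F * ⇑G * ⇑G) - L.g₃ • (⇑G * ⇑G * ⇑G))) with hΦdef
  set U : ℂ → ℂ := fun w ↦ eichlerIntegral f (ofComplex w) with hU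
  set X : ℂ → ℂ := fun w ↦ ℘[L] (eichlerIntegral f (ofComplex w)) with hX
  set Fc : ℂ → ℂ := ⇑F ∘ ofComplex with hFc
  set Gc : ℂ → ℂ := ⇑G ∘ ofComplex with hGc
  set Ω : Set ℂ := {z : ℂ | 0 < z.im ∧ eichlerIntegral f (ofComplex z) ∉ L.lattice} with hΩ
  have hΩo : IsOpen Ω := isOpen_setOf_eichlerIntegral_notMem_lattice f L
  have hF1 := isCuspFunction_one_gamma1 F
  have hG1 := isCuspFunction_one_gamma1 G
  -- Step 1: the identity on `Ω`
  have hstep : ∀ z ∈ Ω, (Φ ∘ ofComplex) z = 0 := by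
    intro z hz
    have hzim : 0 < z.im := hz.1
    -- `Fc = X * Gc` near `z`
    have hloc : Fc =ᶠ[𝓝 z] X * Gc := by
      filter_upwards [hΩo.mem_nhds hz] with w hw
      simp only [hFc, hX, hGc, comp_apply, Pi.mul_apply]
      exact (hFG (ofComplex w) hw.2).symm
    have hXd : DifferentiableAt ℂ X z := (analyticOnNhd_weierstrassP_eichlerIntegral f L z hz).differentiableAt
    have hGd : DifferentiableAt ℂ Gc z := (hG1.analyticAt_comp_ofComplex hzim).differentiableAt
    have hdF : deriv Fc z = deriv X z * Gc z + X z * deriv Gc z := by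
      rw [hloc.deriv_eq]
      exact deriv_mul hXd hGd
    have hFz : Fc z = X z * Gc z := hloc.self_of_nhds
    have hode := deriv_weierstrassP_eichlerIntegral_sq f L hzim hz.2
    have hUd := deriv_eichlerIntegral_comp_ofComplex f hzim
    simp only [comp_apply, hΦdef, Pi.sub_apply, Pi.mul_apply, Pi.smul_apply, smul_eq_mul,
      ofComplex_apply_of_im_pos hzim]
    -- rewrite everything in terms of `X z`, `deriv X z`, `Gc z`, `deriv Gc z`, `f`
    have e1 : (F : ℍ → ℂ) ⟨z, hzim⟩ = Fc z := by simp [hFc, ofComplex_apply_of_im_pos hzim]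
    have e2 : (G : ℍ → ℂ) ⟨z, hzim⟩ = Gc z := by simp [hGc, ofComplex_apply_of_im_pos hzim]
    have e3 : (f : ℍ → ℂ) ⟨z, hzim⟩ = f (ofComplex z) := by rw [ofComplex_apply_of_im_pos hzim]
    rw [e1, e2, e3, hdF, hFz]
    rw [hUd] at hode
    rw [show deriv X z = deriv (fun w : ℂ ↦ ℘[L] (eichlerIntegral f (ofComplex w))) z from rfl]
    linear_combination (Gc z) ^ 4 * hode
  -- Step 2: spread over the half-plane by the identity theorem
  have han : AnalyticOnNhd ℂ (Φ ∘ ofComplex) {z : ℂ | 0 < z.im} := fun z hz ↦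
    hΦ.analyticAt_comp_ofComplex hz
  have hconn : IsPreconnected {z : ℂ | 0 < z.im} := convex_setOf_im_pos.isPreconnected
  obtain ⟨z₀, hz₀⟩ := nonempty_diff_of_countable (countable_setOf_eichlerIntegral_mem_lattice f L hf)
  have hz₀Ω : z₀ ∈ Ω := by
    refine ⟨hz₀.1, fun h ↦ hz₀.2 ⟨hz₀.1, h⟩⟩
  have hev : (Φ ∘ ofComplex) =ᶠ[𝓝 z₀] 0 := by
    filter_upwards [hΩo.mem_nhds hz₀Ω] with z hz
    exact hstep z hz
  have hzero := han.eqOn_zero_of_preconnected_of_eventuallyEq_zero hconn hz₀.1 hev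
  funext τ
  have := hzero τ.im_pos
  simpa [comp_apply, ofComplex_apply] using this

/-! ### From the differential identity to the differential equation of `F₁/G₁` -/

/-- **The identity gives the differential equation of the quotient**: if
`(G₁·F₁′ − F₁·G₁′)² − (2πi)²·f²G₁(4F₁³ − AF₁G₁² − BG₁³) = 0` on `ℍ`, then at every `z` of the
half-plane with `G₁(z) ≠ 0` the function `h = F₁/G₁` (of the complex variable) satisfies
`h′(z)² = u′(z)²·(4h(z)³ − Ah(z) − B)`, `u′ = 2πi f` (quotient rule). [folklore] -/
theorem deriv_div_sq_of_odeFun_eq_zero (f : CuspForm (Gamma0 N) 2) (F₁ G₁ : CuspForm (Gamma1 N) k)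
    (A B : ℂ)
    (h : (⇑G₁ * (fun τ : ℍ ↦ deriv (⇑F₁ ∘ ofComplex) τ) - ⇑F₁ * (fun τ : ℍ ↦ deriv (⇑G₁ ∘ ofComplex) τ)) *
        (⇑G₁ * (fun τ : ℍ ↦ deriv (⇑F₁ ∘ ofComplex) τ) - ⇑F₁ * (fun τ : ℍ ↦ deriv (⇑G₁ ∘ ofComplex) τ)) -
      ((2 * π * I) ^ 2 : ℂ) • (⇑f * ⇑f * ⇑G₁ *
        ((4 : ℂ) • (⇑F₁ * ⇑F₁ * ⇑F₁) - A • (⇑F₁ * ⇑G₁ * ⇑G₁) - B • (⇑G₁ * ⇑G₁ * ⇑G₁))) = 0)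
    {z : ℂ} (hz : 0 < z.im) (hG : (⇑G₁ ∘ ofComplex) z ≠ 0) :
    deriv (fun w : ℂ ↦ (⇑F₁ ∘ ofComplex) w / (⇑G₁ ∘ ofComplex) w) z ^ 2 =
      deriv (fun w : ℂ ↦ eichlerIntegral f (ofComplex w)) z ^ 2 *
        (4 * ((⇑F₁ ∘ ofComplex) z / (⇑G₁ ∘ ofComplex) z) ^ 3 -
          A * ((⇑F₁ ∘ ofComplex) z / (⇑G₁ ∘ ofComplex) z) - B) := by
  have hF1 := isCuspFunction_one_gamma1 F₁
  have hG1 := isCuspFunction_one_gamma1 G₁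
  have hFd : DifferentiableAt ℂ (⇑F₁ ∘ ofComplex) z := (hF1.analyticAt_comp_ofComplex hz).differentiableAt
  have hGd : DifferentiableAt ℂ (⇑G₁ ∘ ofComplex) z := (hG1.analyticAt_comp_ofComplex hz).differentiableAt
  have hquot : deriv (fun w : ℂ ↦ (⇑F₁ ∘ ofComplex) w / (⇑G₁ ∘ ofComplex) w) z =
      (deriv (⇑F₁ ∘ ofComplex) z * (⇑G₁ ∘ ofComplex) z -
        (⇑F₁ ∘ ofComplex) z * deriv (⇑G₁ ∘ ofComplex) z) / (⇑G₁ ∘ ofComplex) z ^ 2 :=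
    (hFd.hasDerivAt.div hGd.hasDerivAt hG).deriv
  rw [hquot, deriv_eichlerIntegral_comp_ofComplex f hz]
  have hτ := congrFun h (ofComplex z)
  simp only [Pi.sub_apply, Pi.mul_apply, Pi.smul_apply, smul_eq_mul, Pi.zero_apply] at hτ
  rw [show ((ofComplex z : ℍ) : ℂ) = z by rw [ofComplex_apply_of_im_pos hz]] at hτ
  set p := (⇑F₁ ∘ ofComplex) z
  set q := (⇑G₁ ∘ ofComplex) z
  set p' := deriv (⇑F₁ ∘ ofComplex) z
  set q' := deriv (⇑G₁ ∘ ofComplex) z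
  have e1 : (F₁ : ℍ → ℂ) (ofComplex z) = p := rfl
  have e2 : (G₁ : ℍ → ℂ) (ofComplex z) = q := rfl
  rw [e1, e2] at hτ
  rw [div_pow, div_eq_iff (pow_ne_zero 2 (pow_ne_zero 2 hG))]
  field_simp
  linear_combination hτ

/-! ### Preimages of countable sets under `τ ↦ γτ` -/

/-- For `γ ∈ SL(2, ℤ)` and a countable `T ⊆ ℂ`, the set of `z` in the upper half-plane with
`γz ∈ T` is countable (`τ ↦ γτ` is a bijection of `ℍ`). [folklore] -/
theorem countable_setOf_smul_mem (γ : SL(2, ℤ)) {T : Set ℂ} (hT : T.Countable) :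
    {z : ℂ | 0 < z.im ∧ ((γ • ofComplex z : ℍ) : ℂ) ∈ T}.Countable := by
  have hsub : {z : ℂ | 0 < z.im ∧ ((γ • ofComplex z : ℍ) : ℂ) ∈ T} ⊆
      (fun w : ℂ ↦ ((γ⁻¹ • ofComplex w : ℍ) : ℂ)) '' T := by
    rintro z ⟨hz, hzT⟩
    refine ⟨_, hzT, ?_⟩
    simp only [ofComplex_apply, inv_smul_smul, ofComplex_apply_of_im_pos hz, UpperHalfPlane.coe_mk]
  exact (hT.image _).mono hsub

/-! ### Fibres of the Eichler integral -/

/-- For `f ≠ 0` every fibre `{u = t}` of the Eichler integral in the half-plane is countable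
(`u` is holomorphic and not constant on the connected half-plane). [folklore] -/
theorem countable_fiber_eichlerIntegral (f : CuspForm (Gamma0 N) 2) (hf : f ≠ 0) (t : ℂ) :
    ({z : ℂ | 0 < z.im} ∩ (fun w : ℂ ↦ eichlerIntegral f (ofComplex w)) ⁻¹' {t}).Countable := by
  have hconn : IsConnected {z : ℂ | 0 < z.im} :=
    ⟨⟨Complex.I, by simp⟩, convex_setOf_im_pos.isPreconnected⟩
  have han : AnalyticOnNhd ℂ (fun w : ℂ ↦ eichlerIntegral f (ofComplex w)) {z : ℂ | 0 < z.im} :=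
    fun z hz ↦ analyticAt_eichlerIntegral_comp_ofComplex f hz
  by_cases hex : ∃ z : ℂ, 0 < z.im ∧ eichlerIntegral f (ofComplex z) ≠ t
  · obtain ⟨z₂, hz₂, hne⟩ := hex
    exact countable_inter_preimage_singleton_of_analyticOnNhd han hconn hz₂ hne
  · simp only [not_exists, not_and, not_not] at hex
    exfalso
    apply not_eventually_const_eichlerIntegral f hf (z := Complex.I) (by simp) t
    filter_upwards [isOpen_upperHalfPlaneSet.mem_nhds (show (0 : ℝ) < Complex.I.im by simp)] with w hw
    exact hex w hw

/-- The zero set, in the half-plane, of a nonzero `Γ₁(N)`-cusp form (as a function of the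
complex variable) is countable. [folklore] -/
theorem countable_zeros_cuspForm (G : CuspForm (Gamma1 N) k) (hG : G ≠ 0) :
    ({z : ℂ | 0 < z.im} ∩ (⇑G ∘ ofComplex) ⁻¹' {0}).Countable := by
  have hconn : IsConnected {z : ℂ | 0 < z.im} :=
    ⟨⟨Complex.I, by simp⟩, convex_setOf_im_pos.isPreconnected⟩
  have hG1 := isCuspFunction_one_gamma1 G
  have han : AnalyticOnNhd ℂ (⇑G ∘ ofComplex) {z : ℂ | 0 < z.im} := fun z hz ↦
    hG1.analyticAt_comp_ofComplex hz
  obtain ⟨τ, hτ⟩ : ∃ τ : ℍ, G τ ≠ 0 := by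
    by_contra h
    simp only [not_exists, not_not] at h
    exact hG (DFunLike.ext' (funext h))
  exact countable_inter_preimage_singleton_of_analyticOnNhd han hconn τ.im_pos
    (by simpa [comp_apply, ofComplex_apply] using hτ)

/-! ### Non-degeneracy of the conjugate quotient -/

/-- **`℘_Λ ∘ u` is not constant on any nonempty open subset of the half-plane** (for `f ≠ 0`):
otherwise the non-constant holomorphic `u` would map an open set into the countable fibre of
`℘_Λ` over a point, and open subsets of `ℂ` are uncountable. [folklore] -/
theorem not_const_weierstrassP_eichlerIntegral (f : CuspForm (Gamma0 N) 2) (hf : f ≠ 0)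
    (L : PeriodPair) {W : Set ℂ} (hWo : IsOpen W) (hWne : W.Nonempty)
    (hW : W ⊆ {z : ℂ | 0 < z.im ∧ eichlerIntegral f (ofComplex z) ∉ L.lattice}) (e : ℂ)
    (hconst : ∀ z ∈ W, ℘[L] (eichlerIntegral f (ofComplex z)) = e) : False := by
  -- the fibre of `℘` over `e` (off the lattice) is countable
  have hΛconn : IsConnected ((L.lattice : Set ℂ)ᶜ) := by
    refine ⟨⟨L.ω₁ / 2, L.ω₁_div_two_notMem_lattice⟩, ?_⟩
    simpa [compl_eq_univ_sdiff] using
      isPreconnected_diff_of_countable (C := univ) convex_univ isOpen_univ L.countable_lattice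
  obtain ⟨z₁, hz₁, hz₁e⟩ := L.exists_weierstrassP_eq (e + 1)
  have hfib : ((L.lattice : Set ℂ)ᶜ ∩ ℘[L] ⁻¹' {e}).Countable :=
    countable_inter_preimage_singleton_of_analyticOnNhd L.analyticOnNhd_weierstrassP hΛconn hz₁
      (by rw [hz₁e]; simp)
  -- the fibres of `u` are countable
  have hufib := countable_fiber_eichlerIntegral f hf
  -- `W` is covered by countably many countable fibres
  have hcover : W ⊆ ⋃ t ∈ ((L.lattice : Set ℂ)ᶜ ∩ ℘[L] ⁻¹' {e}),
      ({z : ℂ | 0 < z.im} ∩ (fun w : ℂ ↦ eichlerIntegral f (ofComplex w)) ⁻¹' {t}) := by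
    intro z hz
    simp only [mem_iUnion, mem_inter_iff, mem_compl_iff, mem_preimage, mem_singleton_iff,
      SetLike.mem_coe, exists_prop, mem_setOf_eq]
    exact ⟨eichlerIntegral f (ofComplex z), ⟨(hW hz).2, hconst z hz⟩, (hW hz).1, rfl⟩
  have hWc : W.Countable := (hfib.biUnion fun t _ ↦ hufib t).mono hcover
  exact not_countable_of_isOpen hWo hWne hWc

end Literature.NumberTheory.EllipticCurves.ModularForms

end
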